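import Mathlib
import Literature.Analysis.FluidPDE.NSQuasipotential
import Summits.NavierStokesRegularity.NavierStokesRegularity.Theorems.QuarterLogPincerBeadCensusDefs
import HarnessLib

/-!
# Junk-model audit of the G-chain: the rest state bites exactly below the separation threshold — refuter lane ns-afl-r1

Supports crux stmt-NavierStokesRegularity-24077 (`QuarterLogPincer.TypeIQuantSubcubicExp`) via ns-idea-7's lines
`bead_census` / `ember_census` / `silencing_cost` (G-chain objects `BeadCensus.GoodLevel`, `CensusAt`,
`FlarePersistenceAt`, in the tree BY NAME, `…Theorems.QuarterLogPincerBeadCensusDefs`).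

BY-NAME successor of this seat's pre-port audit `…Negative.BeadCensusGuardTight` (p697535, which had to RESTATE
the line's definitions because `Cruxes/…/Lines/*.lean` is not importable): the same junk-model facts now stated for
the ported decls of record (`…Theorems.QuarterLogPincerBeadCensusDefs`), so G-chain provers can apply them without
unfolding two copies, plus the census version (`censusAt_false_below_threshold`, new).

Refuter step 6(ii) (instantiate at the junk model) made kernel.  The annulus range of `GoodLevel M μ a u t₁ x₀ k`
(`4M√s_k ≤ R`, `M^{10μ}R ≤ e^{a}√s_k`) is nonempty iff `log(4M^{1+10μ}) ≤ a` (`log_le_of_goodLevel`); hence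
BELOW that separation every level of every solution is bad, and the REST STATE `u ≡ 0` (a classical solution
in the crux's frame, Type-I for every `M > 0`, `‖u‖₃ = 0 ≤ A`) refutes `FlarePersistenceAt M μ a c` for every
`c > 0` (`flarePersistenceAt_false_below_threshold`: the trace of `0` on the shell is `0 < c`) and
`CensusAt M μ a C` for every `C` (`censusAt_false_below_threshold`: all `n` levels are bad, `n > 8C`).  ABOVE
the threshold the rest state is harmless: every level is good with `R = 4M√s_k`
(`goodLevel_zero_of_threshold_le`).  Reading for the G-chain: the thresholds `a₀(μ,M)` of `BeadCensus` /
`FlarePersistence` must satisfy `a₀ ≥ log(4M^{1+10μ})` — the docstring's remark (v1.2, critic N2) is now a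
theorem, and the junk model is excluded by exactly that much and no more.

HONEST FRAME: facts about the line's own objects at the zero solution; no statement of the route is proved
or refuted; 24077, W7 and Navier–Stokes regularity remain OPEN.  Theorem-only file.
-/

set_option linter.dupNamespace false

namespace Summit.NavierStokesRegularity.NavierStokesRegularity.Theorems.TypeIQuantSubcubicExp.Negative.BeadCensus

noncomputable section

open MeasureTheory Set Metric
open scoped ENNReal NNReal
open Literature.Analysis Literature.Analysis.FluidPDE
open Summit.NavierStokesRegularity.NavierStokesRegularity.Cruxes.TypeIQuantSubcubicExp.BeadCensus

/-- The level scales are positive for `t₁ > 0`. -/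
theorem levelScale_port_pos {a t₁ : ℝ} (ht₁ : 0 < t₁) (k : ℕ) : 0 < levelScale a t₁ k :=
  mul_pos ht₁ (Real.exp_pos _)

/-- **The separation threshold.**  A good level (for any field `u`) forces `log(4M^{1+10μ}) ≤ a`: the annulus
range `4M√s ≤ R`, `M^{10μ}R ≤ e^{a}√s` is nonempty only then. -/
theorem log_le_of_goodLevel {M μ a t₁ : ℝ} {u : ℝ → (EuclideanSpace ℝ (Fin 3)) → (EuclideanSpace ℝ (Fin 3))}
    {x₀ : EuclideanSpace ℝ (Fin 3)} {k : ℕ} (hM : 0 < M) (ht₁ : 0 < t₁)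
    (h : GoodLevel M μ a u t₁ x₀ k) : Real.log (4 * M ^ (1 + 10 * μ)) ≤ a := by
  obtain ⟨R, h1, h2, -⟩ := h
  have hs : 0 < Real.sqrt (levelScale a t₁ k) := Real.sqrt_pos.2 (levelScale_port_pos ht₁ k)
  have hMμ : 0 < M ^ (10 * μ) := Real.rpow_pos_of_pos hM _
  have hpow : M ^ (1 + 10 * μ) = M * M ^ (10 * μ) := by
    rw [Real.rpow_add hM, Real.rpow_one]
  have hkey : 4 * M ^ (1 + 10 * μ) * Real.sqrt (levelScale a t₁ k) ≤
      Real.exp a * Real.sqrt (levelScale a t₁ k) := by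
    rw [hpow]
    calc 4 * (M * M ^ (10 * μ)) * Real.sqrt (levelScale a t₁ k)
        = M ^ (10 * μ) * (4 * M * Real.sqrt (levelScale a t₁ k)) := by ring
      _ ≤ M ^ (10 * μ) * R := mul_le_mul_of_nonneg_left h1 hMμ.le
      _ ≤ Real.exp a * Real.sqrt (levelScale a t₁ k) := h2
  have h4 : 0 < 4 * M ^ (1 + 10 * μ) := by positivity
  rw [Real.log_le_iff_le_exp h4]
  exact le_of_mul_le_mul_right hkey hs

/-- Above the threshold the rest state is harmless: every level of `u ≡ 0` is good (`R = 4M√s_k`). -/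
theorem goodLevel_zero_of_threshold_le {M μ a t₁ : ℝ} {x₀ : EuclideanSpace ℝ (Fin 3)} {k : ℕ}
    (hM : 0 < M) (ht₁ : 0 < t₁) (ha : Real.log (4 * M ^ (1 + 10 * μ)) ≤ a) :
    GoodLevel M μ a (0 : ℝ → (EuclideanSpace ℝ (Fin 3)) → (EuclideanSpace ℝ (Fin 3))) t₁ x₀ k := by
  have hs : 0 < Real.sqrt (levelScale a t₁ k) := Real.sqrt_pos.2 (levelScale_port_pos ht₁ k)
  have h4 : 0 < 4 * M ^ (1 + 10 * μ) := by positivity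
  have hexp : 4 * M ^ (1 + 10 * μ) ≤ Real.exp a := (Real.log_le_iff_le_exp h4).1 ha
  have hpow : M ^ (1 + 10 * μ) = M * M ^ (10 * μ) := by
    rw [Real.rpow_add hM, Real.rpow_one]
  refine ⟨4 * M * Real.sqrt (levelScale a t₁ k), le_rfl, ?_, ?_⟩
  · calc M ^ (10 * μ) * (4 * M * Real.sqrt (levelScale a t₁ k))
        = 4 * M ^ (1 + 10 * μ) * Real.sqrt (levelScale a t₁ k) := by rw [hpow]; ring
      _ ≤ Real.exp a * Real.sqrt (levelScale a t₁ k) := mul_le_mul_of_nonneg_right hexp hs.le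
  · intro t _ x _ _ j _
    have h0 : iteratedFDeriv ℝ j ((0 : ℝ → (EuclideanSpace ℝ (Fin 3)) → (EuclideanSpace ℝ (Fin 3))) t) x = 0 := by
      rw [Pi.zero_apply, Pi.zero_def, iteratedFDeriv_fun_zero, Pi.zero_apply]
    rw [h0, norm_zero]
    exact mul_nonneg (Real.rpow_nonneg hM.le _) (Real.rpow_nonneg (levelScale_port_pos ht₁ k).le _)

/-- The rest state is in the crux's frame: a classical solution on `[0,T]` (`ν = 1`, zero force, zero
pressure) with all slice Sobolev norms `0`. -/
theorem frame_zero (T : ℝ) :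
    IsClassicalNSSolutionOn (Icc 0 T) 1 0 (0 : ℝ → (EuclideanSpace ℝ (Fin 3)) → (EuclideanSpace ℝ (Fin 3))) 0 ∧
      ∀ m : ℕ, ∃ C : NNReal, ∀ t ∈ Icc 0 T,
        eLpNorm (iteratedFDeriv ℝ m ((0 : ℝ → (EuclideanSpace ℝ (Fin 3)) → (EuclideanSpace ℝ (Fin 3))) t))
          2 volume ≤ C := by
  refine ⟨isClassicalNSSolutionOn_zero _ _, fun m => ⟨0, fun t _ => ?_⟩⟩
  rw [Pi.zero_apply, Pi.zero_def, iteratedFDeriv_fun_zero, eLpNorm_zero]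
  exact le_rfl

/-- The rest state obeys the virtual Type-I bound for every `M ≥ 0`, `τ > 0`. -/
theorem typeI_zero {M T τ : ℝ} (hM : 0 ≤ M) (hτ : 0 < τ) :
    ∀ t ∈ Icc 0 T, ∀ x : EuclideanSpace ℝ (Fin 3),
      ‖(0 : ℝ → (EuclideanSpace ℝ (Fin 3)) → (EuclideanSpace ℝ (Fin 3))) t x‖ ≤
        M * (T + τ - t) ^ (-(1 / 2 : ℝ)) := by
  intro t ht x
  rw [Pi.zero_apply, Pi.zero_apply, norm_zero]
  exact mul_nonneg hM (Real.rpow_nonneg (by linarith [ht.2]) _)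

/-- The rest state has `L³` norm `0 ≤ A`. -/
theorem L3_zero {T A : ℝ} :
    ∀ t ∈ Icc 0 T,
      eLpNorm ((0 : ℝ → (EuclideanSpace ℝ (Fin 3)) → (EuclideanSpace ℝ (Fin 3))) t) 3 volume ≤
        ENNReal.ofReal A := by
  intro t _
  rw [Pi.zero_apply, eLpNorm_zero]
  exact zero_le

/-- **G1♯ below the threshold is refuted by the rest state.**  For `M > 0`, `c > 0` and separation
`a < log(4M^{1+10μ})`, `FlarePersistenceAt M μ a c` fails: level `1` of `u ≡ 0` about `x₀ = 0` at `t₁ = 1`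
is bad (empty annulus range) while its shell trace is `0 < c`.  Hence the threshold `a₀(μ,M)` of
`FlarePersistence` is necessarily `≥ log(4M^{1+10μ})`. -/
theorem flarePersistenceAt_false_below_threshold {M μ a c : ℝ} (hM : 0 < M) (hc : 0 < c)
    (ha : a < Real.log (4 * M ^ (1 + 10 * μ))) : ¬ FlarePersistenceAt M μ a c := by
  intro h
  have hbad : ¬ GoodLevel M μ a (0 : ℝ → (EuclideanSpace ℝ (Fin 3)) → (EuclideanSpace ℝ (Fin 3))) 1 0
      (0 + 1) :=
    fun hg => absurd ha (not_lt.2 (log_le_of_goodLevel hM one_pos hg))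
  have h1 := h 1 1 2 1 0 0 0 0 (frame_zero 1) one_pos (typeI_zero hM.le one_pos) L3_zero le_rfl
    ⟨one_pos, le_rfl⟩ hbad
  have hint : ∫⁻ x in levelShell M a 1 0 (0 + 1),
      ‖(0 : ℝ → (EuclideanSpace ℝ (Fin 3)) → (EuclideanSpace ℝ (Fin 3))) 1 x‖ₑ ^ (3 : ℝ) = 0 := by
    have h3 : (0 : ℝ≥0∞) ^ (3 : ℝ) = 0 := ENNReal.zero_rpow_of_pos (by norm_num)
    simp [h3]
  rw [hint, nonpos_iff_eq_zero, ENNReal.ofReal_eq_zero] at h1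
  exact absurd hc (not_lt.2 h1)

/-- **The census below the threshold is refuted by the rest state.**  For `M > 0` and
`a < log(4M^{1+10μ})`, `CensusAt M μ a C` fails for every `C`: all `n` levels of `u ≡ 0` are bad, and
`n = ⌈8C⌉ + 1 > C·2³`.  Hence the threshold `a₀(μ,M)` of `BeadCensus` is necessarily `≥ log(4M^{1+10μ})`. -/
theorem censusAt_false_below_threshold {M μ a C : ℝ} (hM : 0 < M)
    (ha : a < Real.log (4 * M ^ (1 + 10 * μ))) : ¬ CensusAt M μ a C := by
  intro h
  have h1 := h 1 1 2 1 0 0 0 (⌈8 * C⌉₊ + 1) (frame_zero 1) one_pos (typeI_zero hM.le one_pos) L3_zero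
    le_rfl ⟨one_pos, le_rfl⟩
  have hall : ∀ k ∈ Finset.range (⌈8 * C⌉₊ + 1),
      ¬ GoodLevel M μ a (0 : ℝ → (EuclideanSpace ℝ (Fin 3)) → (EuclideanSpace ℝ (Fin 3))) 1 0 (k + 1) :=
    fun k _ hg => absurd ha (not_lt.2 (log_le_of_goodLevel hM one_pos hg))
  rw [@Finset.filter_true_of_mem _ _ (_) _ hall, Finset.card_range] at h1
  have hC : (8 * C : ℝ) < (⌈8 * C⌉₊ : ℝ) + 1 := lt_of_le_of_lt (Nat.le_ceil _) (lt_add_one _)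
  push_cast at h1
  linarith

end

end Summit.NavierStokesRegularity.NavierStokesRegularity.Theorems.TypeIQuantSubcubicExp.Negative.BeadCensus
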